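import Summits.MatrixMultiplication.MatrixMultiplication.Theorems.AsymptoticRankCWBPerm3Form
import Literature.Computability.AlgebraicComplexity.QuantumFunctionals
import Literature.Barriers.MatrixMultiplication.UniversalMethodBarrier

/-!
# No honest degeneration from the skew sibling to `T_cw,2`
(route `MatrixMultiplication/AsymptoticRankCW`; item `BSkewDominatesCw` = stmt-MatrixMultiplication-18009,
line `skew_anchor` of the crux `BThesis` = stmt-MatrixMultiplication-0588)

`BSkewDominatesCw` asks for `R̃(T_cw,2) ≤ R̃(ε)`, `ε` the Levi-Civita tensor on `Fin 3` (inline as in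
the route file). Since `R̃` is monotone under restriction and degeneration, the cheapest conceivable
proof would be an honest restriction `ε ≥ T_cw,2` or degeneration `ε ⊵ T_cw,2` inside
`ℂ³ ⊗ ℂ³ ⊗ ℂ³`. This file proves, kernel-checked, that NEITHER exists:

* `sliceMatrix_actTensor` — the `x`-slice `∑ₐ xₐ t(a,·,·)` of `(A ⊗ B ⊗ C)·t` is
  `B · (slice of t at xA) · Cᵀ`;
* `det_sliceMatrix_leviCivita` — every `x`-slice of `ε` is a `3 × 3` skew-symmetric matrix, so its
  determinant vanishes identically;
* hence `det (slice) = 0` on every restriction of `ε` (`det_sliceMatrix_eq_zero_of_restrictsTo`) and,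
  by continuity of the determinant, on every degeneration of `ε`
  (`det_sliceMatrix_eq_zero_of_degeneratesTo`, CVZ Rem. 1.2: orbit closure);
* but the slice of `T_cw,2` at `x = (1,1,0)` has determinant `-1` (`det_sliceMatrix_cwTensor_two`);
* `not_tensorRestrictsTo_leviCivita_cwTensor_two`, `not_tensorDegeneratesTo_leviCivita_cwTensor_two`;
* `not_polyDegeneratesTo_leviCivita_cwTensor_two` — the same for the tree's `ℂ[λ]`-degenerations
  `PolyDegeneratesTo` (Alman 2021 §2.4), the notion under which `asymptoticRank_le_of_polyDegeneratesTo`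
  is monotone: the slice of the `ℂ[λ]`-tensor is `λ^h (S + O(λ))` with `det S = -1`, so its
  determinant is `λ^{3h}(-1 + O(λ)) ≠ 0`, against `det = 0` from skewness.

So the content of `BSkewDominatesCw` is genuinely asymptotic (a degeneration
`ε^{⊠(N+o(N))} ⊵ T_cw,2^{⊠N}` between DIFFERENT formats, or a spectral classification), as the
crux-strategist census asserts on GIT grounds (both tensors are polystable); the slice-determinant
invariant used here is elementary and specific to `N = 1` (already `det₃ ≅ ε ⊠ ε` has non-singular
slices).

References: M. Christandl, P. Vrana, J. Zuiddam, JAMS 36 (2023), §1.1 and Rem. 1.2 (restriction,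
degeneration, monotonicity of `R̃`); A. Conner, F. Gesmundo, J. M. Landsberg, E. Ventura,
comput. complexity 31 (2022), §2.2 (the skew sibling).
-/

set_option linter.dupNamespace false

noncomputable section

namespace Summit.MatrixMultiplication.MatrixMultiplication.Theorems

open scoped BigOperators
open Matrix
open Literature.Computability.AlgebraicComplexity

/-! ## Slices of acted tensors -/

section Slice

variable {K : Type*} [CommRing K] {ι κ μ ι' κ' μ' : Type*} [Fintype ι] [Fintype κ] [Fintype μ]
  [Fintype ι']

/-- **Slices of `(A ⊗ B ⊗ C)·t`.** The `x`-slice (the `κ' × μ'` matrix `∑ₐ xₐ t'(a,·,·)`) of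
`t' = (A ⊗ B ⊗ C)·t` equals `B · S · Cᵀ`, where `S` is the slice of `t` at the vector `x A`
(`(xA)_{a'} = ∑ₐ xₐ A_{a a'}`). [folklore] -/
theorem sliceMatrix_actTensor (A : Matrix ι' ι K) (B : Matrix κ' κ K) (C : Matrix μ' μ K)
    (t : ι → κ → μ → K) (x : ι' → K) :
    (Matrix.of fun (b : κ') (c : μ') => ∑ a, x a * actTensor A B C t a b c) =
      B * (Matrix.of fun (b' : κ) (c' : μ) => ∑ a', (∑ a, x a * A a a') * t a' b' c') * Cᵀ := by
  ext b c
  simp only [Matrix.of_apply, Matrix.mul_apply, Matrix.transpose_apply, actTensor_apply,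
    Finset.mul_sum, Finset.sum_mul]
  -- both sides are the quadruple sum of `x a * A a a' * B b b' * C c c' * t a' b' c'`
  calc ∑ a, ∑ a', ∑ b', ∑ c', x a * (A a a' * B b b' * C c c' * t a' b' c')
      = ∑ a, ∑ c', ∑ b', ∑ a', x a * (A a a' * B b b' * C c c' * t a' b' c') := by
        refine Finset.sum_congr rfl fun a _ => ?_
        calc ∑ a', ∑ b', ∑ c', x a * (A a a' * B b b' * C c c' * t a' b' c')
            = ∑ a', ∑ c', ∑ b', x a * (A a a' * B b b' * C c c' * t a' b' c') :=
              Finset.sum_congr rfl fun a' _ => Finset.sum_comm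
          _ = ∑ c', ∑ a', ∑ b', x a * (A a a' * B b b' * C c c' * t a' b' c') := Finset.sum_comm
          _ = ∑ c', ∑ b', ∑ a', x a * (A a a' * B b b' * C c c' * t a' b' c') :=
              Finset.sum_congr rfl fun c' _ => Finset.sum_comm
    _ = ∑ c', ∑ a, ∑ b', ∑ a', x a * (A a a' * B b b' * C c c' * t a' b' c') := Finset.sum_comm
    _ = ∑ c', ∑ b', ∑ a, ∑ a', x a * (A a a' * B b b' * C c c' * t a' b' c') :=
        Finset.sum_congr rfl fun c' _ => Finset.sum_comm
    _ = ∑ c', ∑ b', ∑ a', ∑ a, x a * (A a a' * B b b' * C c c' * t a' b' c') :=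
        Finset.sum_congr rfl fun c' _ => Finset.sum_congr rfl fun b' _ => Finset.sum_comm
    _ = ∑ c', ∑ b', ∑ a', ∑ a, B b b' * (x a * A a a' * t a' b' c') * C c c' := by
        refine Finset.sum_congr rfl fun c' _ => Finset.sum_congr rfl fun b' _ =>
          Finset.sum_congr rfl fun a' _ => Finset.sum_congr rfl fun a _ => ?_
        ring

/-- Consequently `det` of the `x`-slice of `(A ⊗ B ⊗ C)·t` is `det B · det S · det C` (square
formats). [folklore] -/
theorem det_sliceMatrix_actTensor {n : Type*} [Fintype n] [DecidableEq n]
    (A : Matrix ι' ι K) (B : Matrix n n K) (C : Matrix n n K)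
    (t : ι → n → n → K) (x : ι' → K) :
    (Matrix.of fun (b : n) (c : n) => ∑ a, x a * actTensor A B C t a b c).det =
      B.det * (Matrix.of fun (b' : n) (c' : n) => ∑ a', (∑ a, x a * A a a') * t a' b' c').det * C.det := by
  rw [sliceMatrix_actTensor, Matrix.det_mul, Matrix.det_mul, Matrix.det_transpose]

end Slice

/-! ## The Levi-Civita tensor has only singular slices; `T_cw,2` does not -/

section LeviCivita

/-- **Every `x`-slice of `ε` is singular**: `∑ₐ yₐ ε(a,·,·)` is the skew-symmetric matrix
`!![0, y₂, -y₁; -y₂, 0, y₀; y₁, -y₀, 0]` (the matrix of `v ↦ y × v`), whose determinant vanishes.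
[folklore] -/
theorem det_sliceMatrix_leviCivita (y : Fin 3 → ℂ) :
    (Matrix.of fun (b : Fin 3) (c : Fin 3) => ∑ a, y a *
      (fun a b c : Fin 3 => (if b = a + 1 ∧ c = a + 2 then (1 : ℂ) else 0) -
        (if b = a + 2 ∧ c = a + 1 then 1 else 0)) a b c).det = 0 := by
  simp [Matrix.det_fin_three, Fin.sum_univ_three]
  ring

/-- **Slices of restrictions of `ε` are singular**: if `ε ≥ s` (any format `ι' × Fin 3 × Fin 3`…
here `s` on `Fin 3 × n × n` is not needed — we state it for `3 × 3 × 3` targets), then every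
`x`-slice of `s` has determinant `0`. [folklore] -/
theorem det_sliceMatrix_eq_zero_of_restrictsTo {s : Fin 3 → Fin 3 → Fin 3 → ℂ}
    (h : TensorRestrictsTo (fun a b c : Fin 3 => (if b = a + 1 ∧ c = a + 2 then (1 : ℂ) else 0) -
      (if b = a + 2 ∧ c = a + 1 then 1 else 0)) s) (x : Fin 3 → ℂ) :
    (Matrix.of fun (b : Fin 3) (c : Fin 3) => ∑ a, x a * s a b c).det = 0 := by
  obtain ⟨A, B, C, hs⟩ := (tensorRestrictsTo_iff_exists_actTensor _ _).1 h
  subst hs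
  rw [det_sliceMatrix_actTensor, det_sliceMatrix_leviCivita, mul_zero, zero_mul]

/-- The slice-determinant at a fixed `x` is a continuous function of the tensor. [folklore] -/
theorem continuous_det_sliceMatrix (x : Fin 3 → ℂ) :
    Continuous fun s : Fin 3 → Fin 3 → Fin 3 → ℂ =>
      (Matrix.of fun (b : Fin 3) (c : Fin 3) => ∑ a, x a * s a b c).det := by
  refine Continuous.matrix_det ?_
  refine continuous_pi fun b => continuous_pi fun c => ?_
  simp only [Matrix.of_apply]
  refine continuous_finsetSum _ fun a _ => ?_
  exact continuous_const.mul
    ((continuous_apply c).comp ((continuous_apply b).comp (continuous_apply a)))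

/-- **Slices of degenerations of `ε` are singular**: the orbit `GL₃³·ε` consists of restrictions of
`ε`, on which every slice-determinant vanishes, and the slice-determinant is continuous, so it
vanishes on the orbit closure (CVZ Rem. 1.2). [cite: ChristandlVranaZuiddam2023, Rem. 1.2] -/
theorem det_sliceMatrix_eq_zero_of_degeneratesTo {s : Fin 3 → Fin 3 → Fin 3 → ℂ}
    (h : TensorDegeneratesTo (fun a b c : Fin 3 => (if b = a + 1 ∧ c = a + 2 then (1 : ℂ) else 0) -
      (if b = a + 2 ∧ c = a + 1 then 1 else 0)) s) (x : Fin 3 → ℂ) :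
    (Matrix.of fun (b : Fin 3) (c : Fin 3) => ∑ a, x a * s a b c).det = 0 := by
  unfold TensorDegeneratesTo at h
  have hclosed : IsClosed {s : Fin 3 → Fin 3 → Fin 3 → ℂ |
      (Matrix.of fun (b : Fin 3) (c : Fin 3) => ∑ a, x a * s a b c).det = 0} :=
    isClosed_eq (continuous_det_sliceMatrix x) continuous_const
  have hsub : (Set.range fun g : GL (Fin 3) ℂ × GL (Fin 3) ℂ × GL (Fin 3) ℂ =>
      actTensor (g.1 : Matrix (Fin 3) (Fin 3) ℂ) (g.2.1 : Matrix (Fin 3) (Fin 3) ℂ)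
        (g.2.2 : Matrix (Fin 3) (Fin 3) ℂ)
        (fun a b c : Fin 3 => (if b = a + 1 ∧ c = a + 2 then (1 : ℂ) else 0) -
          (if b = a + 2 ∧ c = a + 1 then 1 else 0))) ⊆
      {s : Fin 3 → Fin 3 → Fin 3 → ℂ | (Matrix.of fun (b : Fin 3) (c : Fin 3) => ∑ a, x a * s a b c).det = 0} := by
    rintro _ ⟨g, rfl⟩
    show (Matrix.of fun (b : Fin 3) (c : Fin 3) => ∑ a, x a * actTensor _ _ _ _ a b c).det = 0
    rw [det_sliceMatrix_actTensor, det_sliceMatrix_leviCivita, mul_zero, zero_mul]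
  exact closure_minimal hsub hclosed h

/-- **`T_cw,2` has a non-singular slice**: at `x = (1,1,0)` the slice of `T_cw,2` is
`!![0,1,0; 1,1,0; 0,0,1]`, of determinant `-1` (in general `det = -x₀(x₁² + x₂²)`). [folklore] -/
theorem det_sliceMatrix_cwTensor_two :
    (Matrix.of fun (b : Fin 3) (c : Fin 3) => ∑ a, (![1, 1, 0] : Fin 3 → ℂ) a * cwTensor ℂ 2 a b c).det = -1 := by
  simp [Matrix.det_fin_three, Fin.sum_univ_three, cwTensor]

/-- **No honest restriction `ε ≥ T_cw,2`.** [folklore] -/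
theorem not_tensorRestrictsTo_leviCivita_cwTensor_two :
    ¬ TensorRestrictsTo (fun a b c : Fin 3 => (if b = a + 1 ∧ c = a + 2 then (1 : ℂ) else 0) -
      (if b = a + 2 ∧ c = a + 1 then 1 else 0)) (cwTensor ℂ 2) := by
  intro h
  have h0 := det_sliceMatrix_eq_zero_of_restrictsTo h ![1, 1, 0]
  rw [det_sliceMatrix_cwTensor_two] at h0
  norm_num at h0

/-- **No honest degeneration `ε ⊵ T_cw,2`** (`T_cw,2 ∉` the orbit closure of `ε` in `ℂ³ ⊗ ℂ³ ⊗ ℂ³`):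
the monotonicity route to `BSkewDominatesCw` through a single-copy degeneration is closed; only
asymptotic (format-changing) degenerations or a spectral argument can prove it.
[cite: ChristandlVranaZuiddam2023, Rem. 1.2] -/
theorem not_tensorDegeneratesTo_leviCivita_cwTensor_two :
    ¬ TensorDegeneratesTo (fun a b c : Fin 3 => (if b = a + 1 ∧ c = a + 2 then (1 : ℂ) else 0) -
      (if b = a + 2 ∧ c = a + 1 then 1 else 0)) (cwTensor ℂ 2) := by
  intro h
  have h0 := det_sliceMatrix_eq_zero_of_degeneratesTo h ![1, 1, 0]
  rw [det_sliceMatrix_cwTensor_two] at h0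
  norm_num at h0

end LeviCivita

/-! ## No polynomial (`ℂ[X]`-) degeneration either -/

section Poly

open Polynomial

/-- The skew slice determinant vanishes over any commutative ring (here `ℂ[X]`, with the entries of
`ε` pushed through `Polynomial.C`). [folklore] -/
theorem det_sliceMatrix_C_leviCivita (y : Fin 3 → ℂ[X]) :
    (Matrix.of fun (b : Fin 3) (c : Fin 3) => ∑ a, y a * Polynomial.C
      ((fun a b c : Fin 3 => (if b = a + 1 ∧ c = a + 2 then (1 : ℂ) else 0) -
        (if b = a + 2 ∧ c = a + 1 then 1 else 0)) a b c)).det = 0 := by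
  simp [Matrix.det_fin_three, Fin.sum_univ_three]
  ring

/-- **No polynomial degeneration `ε ⊵ T_cw,2`** in the sense of the tree's `PolyDegeneratesTo`
(Alman 2021 §2.4: `(A(λ) ⊗ B(λ) ⊗ C(λ))·ε = λ^h T_cw,2 + O(λ^{h+1})` over `ℂ[λ]`) — the notion under
which `asymptoticRank_le_of_polyDegeneratesTo` is monotone. Proof: the `x = (1,1,0)` slice `S'` of the
`ℂ[λ]`-tensor on the left is `Bᵀ · (skew slice) · C`, so `det S' = 0`; on the right every entry of
`S'` is `λ^h (S_{bc} + O(λ))` with `S` the slice of `T_cw,2`, so `det S' = λ^{3h} (det S + O(λ))`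
with `det S = -1 ≠ 0`. [cite: Alman2021, §2.4] -/
theorem not_polyDegeneratesTo_leviCivita_cwTensor_two :
    ¬ Literature.Barriers.MatrixMultiplication.PolyDegeneratesTo
      (fun a b c : Fin 3 => (if b = a + 1 ∧ c = a + 2 then (1 : ℂ) else 0) -
        (if b = a + 2 ∧ c = a + 1 then 1 else 0)) (cwTensor ℂ 2) := by
  rintro ⟨h, A, B, C, hdeg⟩
  -- the `ℂ[X]`-tensor `T'` of the degeneration and its slice `S'` at `x = (1,1,0)`
  set T' : Fin 3 → Fin 3 → Fin 3 → ℂ[X] := fun a' b' c' => ∑ a, ∑ b, ∑ c, Polynomial.C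
    ((fun a b c : Fin 3 => (if b = a + 1 ∧ c = a + 2 then (1 : ℂ) else 0) -
      (if b = a + 2 ∧ c = a + 1 then 1 else 0)) a b c) * (A a a' * B b b' * C c c') with hT'
  have hdeg' : ∀ a' b' c' : Fin 3, ∀ j ≤ h,
      (T' a' b' c').coeff j = if j = h then cwTensor ℂ 2 a' b' c' else 0 := hdeg
  set S' : Matrix (Fin 3) (Fin 3) ℂ[X] := Matrix.of fun (b' : Fin 3) (c' : Fin 3) =>
    ∑ a', Polynomial.C ((![1, 1, 0] : Fin 3 → ℂ) a') * T' a' b' c' with hS'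
  -- (1) `det S' = 0`: `T'` is an acted copy of `C ∘ ε`, whose slices are skew
  have hT'act : T' = actTensor Aᵀ Bᵀ Cᵀ (fun a b c : Fin 3 => Polynomial.C
      ((fun a b c : Fin 3 => (if b = a + 1 ∧ c = a + 2 then (1 : ℂ) else 0) -
        (if b = a + 2 ∧ c = a + 1 then 1 else 0)) a b c)) := by
    funext a' b' c'
    simp only [hT', actTensor_apply, Matrix.transpose_apply]
    refine Finset.sum_congr rfl fun a _ => Finset.sum_congr rfl fun b _ =>
      Finset.sum_congr rfl fun c _ => ?_
    ring
  have hdet0 : S'.det = 0 := by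
    have e1 : S' = Matrix.of fun (b' : Fin 3) (c' : Fin 3) =>
        ∑ a', Polynomial.C ((![1, 1, 0] : Fin 3 → ℂ) a') *
          actTensor Aᵀ Bᵀ Cᵀ (fun a b c : Fin 3 => Polynomial.C
            ((fun a b c : Fin 3 => (if b = a + 1 ∧ c = a + 2 then (1 : ℂ) else 0) -
              (if b = a + 2 ∧ c = a + 1 then 1 else 0)) a b c)) a' b' c' := by
      rw [hS', hT'act]
    have e2 := det_sliceMatrix_C_leviCivita
      (fun a' => ∑ a, Polynomial.C ((![1, 1, 0] : Fin 3 → ℂ) a) * Aᵀ a a')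
    beta_reduce at e2
    rw [e1, det_sliceMatrix_actTensor, e2, mul_zero, zero_mul]
  -- (2) the coefficients of the entries of `S'` up to degree `h`
  have hcoeff : ∀ b' c' : Fin 3, ∀ j ≤ h, (S' b' c').coeff j =
      if j = h then ∑ a', (![1, 1, 0] : Fin 3 → ℂ) a' * cwTensor ℂ 2 a' b' c' else 0 := by
    intro b' c' j hj
    simp only [hS', Matrix.of_apply, Polynomial.finsetSum_coeff, Polynomial.coeff_C_mul]
    by_cases hjh : j = h
    · rw [if_pos hjh]
      refine Finset.sum_congr rfl fun a' _ => ?_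
      rw [hdeg' a' b' c' j hj, if_pos hjh]
    · rw [if_neg hjh]
      refine Finset.sum_eq_zero fun a' _ => ?_
      rw [hdeg' a' b' c' j hj, if_neg hjh, mul_zero]
  -- (3) `S' = X^h • Q` with `Q(0) = S`, the slice of `T_cw,2`
  have hdvd : ∀ b' c' : Fin 3, ∃ q : ℂ[X], S' b' c' = X ^ h * q := by
    intro b' c'
    have hd : (X : ℂ[X]) ^ h ∣ S' b' c' := by
      rw [Polynomial.X_pow_dvd_iff]
      intro d hd
      rw [hcoeff b' c' d hd.le, if_neg hd.ne]
    obtain ⟨q, hq⟩ := hd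
    exact ⟨q, hq⟩
  choose q hq using hdvd
  have hSQ : S' = (X : ℂ[X]) ^ h • Matrix.of q := by
    refine Matrix.ext fun b' c' => ?_
    rw [Matrix.smul_apply, Matrix.of_apply, smul_eq_mul]
    exact hq b' c'
  have hq0 : ∀ b' c' : Fin 3, (q b' c').coeff 0 =
      ∑ a', (![1, 1, 0] : Fin 3 → ℂ) a' * cwTensor ℂ 2 a' b' c' := by
    intro b' c'
    have e := hcoeff b' c' h le_rfl
    rw [if_pos rfl, hq b' c', Polynomial.coeff_X_pow_mul', if_pos le_rfl, Nat.sub_self] at e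
    exact e
  have hdetQ0 : (Matrix.of q).det.coeff 0 =
      (Matrix.of fun (b : Fin 3) (c : Fin 3) =>
        ∑ a, (![1, 1, 0] : Fin 3 → ℂ) a * cwTensor ℂ 2 a b c).det := by
    rw [← Polynomial.constantCoeff_apply, RingHom.map_det, RingHom.mapMatrix_apply]
    congr 1
    ext b' c'
    rw [Matrix.map_apply, Matrix.of_apply, Matrix.of_apply, Polynomial.constantCoeff_apply]
    exact hq0 b' c'
  -- (4) contradiction: `det S' = X^{3h} det Q ≠ 0`
  have hQne : (Matrix.of q).det ≠ 0 := by
    intro h0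
    have e := hdetQ0
    rw [h0, Polynomial.coeff_zero, det_sliceMatrix_cwTensor_two] at e
    norm_num at e
  have hne : S'.det ≠ 0 := by
    rw [hSQ, Matrix.det_smul, Fintype.card_fin]
    exact mul_ne_zero (pow_ne_zero _ (pow_ne_zero _ Polynomial.X_ne_zero)) hQne
  exact hne hdet0

end Poly

end Summit.MatrixMultiplication.MatrixMultiplication.Theorems

end
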